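import Summits.NavierStokesRegularity.FluidComputer.GateBudgetRadiusLipschitz
import HarnessLib

/-!
# What no tuning can beat, part 54: THE PULSE WINDOW, HORIZON-FREE — part 18's typed hitting
# times (the clock surrenders, is crossed, stays dead; the catalyst douses) with the armed ring
# and the trigger's ceiling as LOCAL hypotheses instead of budgets growing from time `0`

Cell `pub-fluidc`, blueprint seat bp1 (gen 34, fifth item, file 1 of 2); same namespace and
conventions as parts 1–53 (`GateBudget*.lean`); imports part 53 (`GateBudgetRadiusLipschitz`)
and through it part 18 = `GateBudgetPulseWindow` (`knob_trigger_pos`, the toolkit's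
`exists_hitTime`), part 10 (`trigger_rise`, `clock_no_return`, `clock_stays_dead`), part 11
(`knob_clock_transit`, `knob_seed_le`), part 5 (`pulse_decay`). Modes `0 = a`, `1 = b` clock, `2
= c` trigger of `fiveGateCircuit ε σ μ R K` (§160) resp. of the knob family `rotorCircuit K M ε
ρ` from (5.6) (§161, §162). HONEST FRAMING (verbatim): low prior, high value-of-information
experiment on Tao's machine paradigm; NOT a claim that NS blows up. Nothing is proved about
the Navier–Stokes equations.

THE POINT (SPEC-INPUT-bp1 §AX, (20′b) HORIZON-FREE RE-TYPING, law 2 of 5). Part 18's pulse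
window `knob_clock_window` / `knob_pulse_window` is the dynamics of every pulse of the ladder,
but two of its inputs grow with the absolute time `s₀` of the pulse: (α) the armed ring is
supplied by part 10's radius law as `ϱ² + 2ε²((s₀ + H)² - s₀²) ≤ b(s₀)² + c(s₀)²` — an
allowance linear in `s₀`, impossible at the ladder's `s₀ ≈ 2.85n`; (β) the trigger's ceiling
inside the two logarithmic residences (`Δ_A`, `Δ_C`) is part 1's budget `c ≤ (ε + σ)t ≤ 2ε(s₀
+ H)`. Both are bookkeeping from time `0`, not dynamics: part 53 §157 makes `√(b² + c²)` `(ε +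
σ)`-Lipschitz at every time, which gives on any horizon of length `H` both a ring `(√R(s₀) - (ε
+ σ)H)²` and a ceiling `c ≤ √R(s₀) + (ε + σ)H` from the ENTRY radius alone. This file re-proves
part 18's two window theorems with (α) and (β) replaced by the local hypotheses `hring : ϱ² ≤ b²
+ c²` on `[s₀, s₀ + H]` and `hcap : c ≤ c_M` on `[s₀, s₀ + H]`; the residences become `Δ_A =
(ε/(Mβ))log(c_M/(λ₁ρ²))`, `Δ_C = (ε/(Mβ))log(c_M/(λρ²))` — no `s₀` anywhere. Part 55
discharges `hring`, `hcap` and `Δ_A + Δ_B + Δ_C ≤ 242/K⁹ < 1/16` for every member of the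
window at ANY ignition time from the entry clock and radius, and adds part 53 §158's kept
radius and the exit clock: the pulse half of a rung in the shape part 52 §154 consumes.
* §160 `rise_residence_cap`: five-gate circuit, `σ ≥ 0`, `μ > 0`; clock alive `b ≥ β > 0` and
  trigger capped `c ≤ c_M` on `[T₁, T₂] ⊆ [0, ∞)`, `c(s) ≥ ℓ > 0` at `s`: every later `t` of
  the window has `t - s ≤ log(c_M/ℓ)/(μβ)` — part 10's `rise_residence` with its budget `(ε +
  σ)t` replaced by the cap.
* §161 `knob_clock_window_free`, §162 `knob_pulse_window_free`: part 18's `knob_clock_window`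
  / `knob_pulse_window` VERBATIM except: hypothesis `harm` ↦ `hring` (the ring itself on the
  horizon), the budget ↦ `hcap`, and `2ε(s₀ + H)` ↦ `c_M` inside `Δ_A`, `Δ_C`; conclusions
  unchanged otherwise (times `s₀ < t₁ < t₂ ≤ T`, `T - s₀ ≤ Δ_A + Δ_B + Δ_C`, `T < s₀ + H`,
  alive / in transit / dead clock, `c(T) ≤ (λ + εe^{-M}/(Mβ))ρ²`, ring and `c > 0` on the
  horizon).
HONEST LIMITS. (i) This file only re-types part 18; the discharge for members is part 55; (ii)
as in part 18 the dead clock is certified only down to `-β` by the window itself (the sharp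
exit clock comes from the kept radius, part 55); (iii) knob family, `0 < ρ² ≤ ε`, `0 < M`;
(iv) nothing about Navier–Stokes.
[cite: Tao2016AveragedNS, §5.5 Theorem 5.3, (5.5), (5.6), (b-eq), (c-eq), proof (ob-2)]
-/

noncomputable section

namespace Summit.NavierStokesRegularity.FluidComputer.GateBudget

open Real Set Filter Topology
open Literature.Analysis.FluidPDE.Tao2016AveragedNS
open Literature.Analysis.FluidPDE.Tao2016AveragedNS.Thm53 (exists_hitTime)

section RiseCap

variable {ε σ μ R K : ℝ} {X : ℝ → Fin 5 → ℝ}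

/-! ## §160 Rise residence under a trigger cap -/

/-- **RISE RESIDENCE UNDER A CAP.** If `b ≥ β > 0` and `c ≤ c_M` on `[T₁, T₂] ⊆ [0, ∞)` (`μ > 0`,
`σ ≥ 0`) and at a time `s` of the window `c(s) ≥ ℓ > 0`, then every later `t` of the window has
`t - s ≤ log(c_M/ℓ)/(μβ)` — part 10's rise law `c(t) ≥ c(s)e^{μβ(t - s)}` against the cap (part
10's `rise_residence` used the budget `c ≤ (ε + σ)t` instead).
[cite: Tao2016AveragedNS, §5.5 (5.5), proof (ob-2)] -/
theorem rise_residence_cap (hX : ∀ t, HasDerivAt X (fiveGateCircuit ε σ μ R K (X t)) t)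
    (h0 : X 0 = delayInit) (hσ : 0 ≤ σ) (hμ : 0 < μ) {T₁ T₂ β ℓ cM : ℝ} (hT₁ : 0 ≤ T₁)
    (hβ : 0 < β) (hb : ∀ t ∈ Icc T₁ T₂, β ≤ X t 1) (hcap : ∀ t ∈ Icc T₁ T₂, X t 2 ≤ cM)
    {s t : ℝ} (hs : s ∈ Icc T₁ T₂) (ht : t ∈ Icc T₁ T₂) (hst : s ≤ t) (hℓ : 0 < ℓ)
    (hcs : ℓ ≤ X s 2) : t - s ≤ log (cM / ℓ) / (μ * β) := by
  have hrise := trigger_rise hX h0 hσ hμ.le hT₁ hb hs ht hst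
  have hct : X t 2 ≤ cM := hcap t ht
  have h1 : ℓ * exp (μ * β * (t - s)) ≤ cM := by
    have := mul_le_mul_of_nonneg_right hcs (exp_pos (μ * β * (t - s))).le
    linarith
  have h2 : exp (μ * β * (t - s)) ≤ cM / ℓ := by
    rw [le_div_iff₀ hℓ, mul_comm]; exact h1
  have h3 : μ * β * (t - s) ≤ log (cM / ℓ) := by
    have := log_le_log (exp_pos _) h2
    rwa [log_exp] at this
  rw [le_div_iff₀ (mul_pos hμ hβ)]
  linarith

end RiseCap

variable {K M ε ρ : ℝ} {X : ℝ → Fin 5 → ℝ}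

/-! ## §161 The clock window, horizon-free -/

/-- **THE CLOCK WINDOW, HORIZON-FREE (knob family).** Along `rotorCircuit K M ε ρ` from (5.6)
(`0 < ρ² ≤ ε`, `0 < M`), let the clock be ARMED at `s₀ ≥ 0`: `b(s₀) > β > 0`, `c(s₀) ≥ λ₁ρ²`
(`λ₁ > 0`); on the horizon `[s₀, s₀ + H]` let the pair keep a RING `b² + c² ≥ ϱ²` with `γ ≥
0`, `γ² + β² ≤ ϱ²`, `Mγ² > ε²`, and the trigger a CEILING `c ≤ c_M`; put `Δ_A =
(ε/(Mβ))log(c_M/(λ₁ρ²))`, `Δ_B = 2εβ/(Mγ² - ε²)` and assume `Δ_A + Δ_B < H`. Then there are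
times `s₀ < t₁ < t₂`, `t₂ - s₀ ≤ Δ_A + Δ_B`, with `b ≥ β` on `[s₀, t₁]`, `b(t₁) = β`; `|b| ≤ β`
on `[t₁, t₂]`, `b(t₂) = -β`; `b ≤ -β` on `[t₂, s₀ + H]`; ring and `c > 0` on `[s₀, s₀ + H]` —
part 18's `knob_clock_window` with its armed-horizon allowance and its budget `2ε(s₀ + H)`
replaced by `hring`, `hcap` (§160 for the residence above `β`).
[cite: Tao2016AveragedNS, §5.5 Theorem 5.3, (5.5), (b-eq), (c-eq), proof (ob-2)] -/
theorem knob_clock_window_free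
    (hX : ∀ t, HasDerivAt X (RotorKnob.rotorCircuit K M ε ρ (X t)) t)
    (h0 : X 0 = delayInit) (hε : 0 < ε) (hρ : 0 < ρ) (hρε : ρ ^ 2 ≤ ε) (hM : 0 < M)
    {s₀ H β ϱ γ lam₁ cM : ℝ} (hs₀ : 0 ≤ s₀) (hH : 0 < H) (hβ : 0 < β) (hβb : β < X s₀ 1)
    (hγ : 0 ≤ γ) (hγϱ : γ ^ 2 + β ^ 2 ≤ ϱ ^ 2) (hγε : ε ^ 2 < M * γ ^ 2)
    (hring : ∀ t ∈ Icc s₀ (s₀ + H), ϱ ^ 2 ≤ X t 1 ^ 2 + X t 2 ^ 2)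
    (hcap : ∀ t ∈ Icc s₀ (s₀ + H), X t 2 ≤ cM)
    (hlam₁ : 0 < lam₁) (hu₁ : lam₁ * ρ ^ 2 ≤ X s₀ 2)
    (hΔ : ε * log (cM / (lam₁ * ρ ^ 2)) / (M * β) + 2 * ε * β / (M * γ ^ 2 - ε ^ 2) < H) :
    ∃ t₁ t₂ : ℝ, s₀ < t₁ ∧ t₁ < t₂ ∧
      t₂ - s₀ ≤ ε * log (cM / (lam₁ * ρ ^ 2)) / (M * β) + 2 * ε * β / (M * γ ^ 2 - ε ^ 2) ∧
      (∀ t ∈ Icc s₀ t₁, β ≤ X t 1) ∧ X t₁ 1 = β ∧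
      (∀ t ∈ Icc t₁ t₂, |X t 1| ≤ β) ∧ X t₂ 1 = -β ∧
      (∀ t ∈ Icc t₂ (s₀ + H), X t 1 ≤ -β) ∧
      (∀ t ∈ Icc s₀ (s₀ + H), ϱ ^ 2 ≤ X t 1 ^ 2 + X t 2 ^ 2) ∧
      (∀ t ∈ Icc s₀ (s₀ + H), 0 < X t 2) := by
  have hρ2 : 0 < ρ ^ 2 := by positivity
  have hMβ : 0 < M * β := mul_pos hM hβ
  have hcs₀ : 0 < X s₀ 2 := lt_of_lt_of_le (by positivity) hu₁
  have hc1 : Continuous fun s => X s 1 := RotorKnob.continuous_traj hX 1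
  have hcpos : ∀ t ∈ Icc s₀ (s₀ + H), 0 < X t 2 := fun t ht =>
    knob_trigger_pos hX h0 hε hM.le hs₀ ht.1 hcs₀
  have hcnn : ∀ t, s₀ ≤ t → 0 ≤ X t 2 := fun t ht => RotorKnob.c_nonneg hX h0 (hs₀.trans ht)
  have hXf := hX
  rw [RotorKnob.rotorCircuit_eq_fiveGate] at hXf
  obtain ⟨hσ0, -⟩ := knob_seed_le hε hρε hM.le
  have hμ : 0 < ε⁻¹ * M := by positivity
  -- the no-return threshold
  have hnoret : ε < ε⁻¹ * M * (ϱ ^ 2 - β ^ 2) := by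
    have h1 : M * γ ^ 2 ≤ M * (ϱ ^ 2 - β ^ 2) := mul_le_mul_of_nonneg_left (by linarith) hM.le
    rw [mul_assoc, lt_inv_mul_iff₀ hε, ← pow_two]
    linarith
  -- the cap at `s₀`: the residence `Δ_A` is non-negative
  have hcM : lam₁ * ρ ^ 2 ≤ cM := hu₁.trans (hcap s₀ ⟨le_rfl, by linarith⟩)
  have hcM0 : 0 < cM := lt_of_lt_of_le (by positivity) hcM
  have hargA : 1 ≤ cM / (lam₁ * ρ ^ 2) := by
    rw [le_div_iff₀ (by positivity), one_mul]; exact hcM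
  have hΔA0 : 0 ≤ ε * log (cM / (lam₁ * ρ ^ 2)) / (M * β) :=
    div_nonneg (mul_nonneg hε.le (log_nonneg hargA)) hMβ.le
  have hγM : 0 < M * γ ^ 2 - ε ^ 2 := by linarith
  have hΔB0 : 0 ≤ 2 * ε * β / (M * γ ^ 2 - ε ^ 2) := div_nonneg (by positivity) hγM.le
  -- ACT ONE: the clock surrenders (`t₁ = s₀ + τA`, the first hitting time of `β` from above)
  have huA : Continuous fun r => -X (s₀ + r) 1 :=
    (hc1.comp (continuous_const.add continuous_id)).neg
  obtain ⟨τA, hτA0, hτAH, hAge, hAeq⟩ := exists_hitTime huA (θ := -β) (T := H) hH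
    (by show -X (s₀ + 0) 1 < -β; rw [add_zero]; linarith)
  have halive : ∀ t ∈ Icc s₀ (s₀ + τA), β ≤ X t 1 := by
    intro t ht
    have h : -X (s₀ + (t - s₀)) 1 ≤ -β := hAge (t - s₀) (by linarith [ht.1]) (by linarith [ht.2])
    rw [add_sub_cancel] at h
    linarith
  have hτAΔ : τA ≤ ε * log (cM / (lam₁ * ρ ^ 2)) / (M * β) := by
    have h1 := rise_residence_cap hXf h0 hσ0 hμ hs₀ hβ halive
      (fun r hr => hcap r ⟨hr.1, by linarith [hr.2]⟩) (s := s₀) (t := s₀ + τA)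
      ⟨le_rfl, by linarith⟩ ⟨by linarith, le_rfl⟩ (by linarith) (by positivity) hu₁
    have heq : log (cM / (lam₁ * ρ ^ 2)) / (ε⁻¹ * M * β)
        = ε * log (cM / (lam₁ * ρ ^ 2)) / (M * β) := by
      field_simp
    linarith [heq ▸ h1]
  have hτAltH : τA < H := by linarith
  have hb1 : X (s₀ + τA) 1 = β := by
    have h : -X (s₀ + τA) 1 = -β := hAeq hτAltH
    linarith
  -- no return above `β` after `t₁` while armed (part 10)
  have hbelow : ∀ t ∈ Icc (s₀ + τA) (s₀ + H), X t 1 ≤ β := fun t ht =>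
    clock_no_return hXf h0 hε.le hμ.le
      (fun r hr => hring r ⟨by linarith [hr.1, hτA0.le], hr.2⟩) hnoret hb1.le ht
  -- ACT TWO: the clock is crossed (`t₂ = t₁ + τB`, the first hitting time of `-β`)
  have huB : Continuous fun r => -X (s₀ + τA + r) 1 :=
    (hc1.comp (continuous_const.add continuous_id)).neg
  obtain ⟨τB, hτB0, hτBH, hBge, hBeq⟩ := exists_hitTime huB (θ := β) (T := H - τA)
    (by linarith) (by show -X (s₀ + τA + 0) 1 < β; rw [add_zero, hb1]; linarith)
  have hnotdead : ∀ t ∈ Icc (s₀ + τA) (s₀ + τA + τB), -β ≤ X t 1 := by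
    intro t ht
    have h : -X (s₀ + τA + (t - (s₀ + τA))) 1 ≤ β :=
      hBge (t - (s₀ + τA)) (by linarith [ht.1]) (by linarith [ht.2])
    rw [add_sub_cancel] at h
    linarith
  have hband : ∀ t ∈ Icc (s₀ + τA) (s₀ + τA + τB), |X t 1| ≤ β := fun t ht =>
    abs_le.2 ⟨hnotdead t ht, hbelow t ⟨ht.1, by linarith [ht.2]⟩⟩
  have hcγ : ∀ t ∈ Icc (s₀ + τA) (s₀ + τA + τB), γ ≤ X t 2 := by
    intro t ht
    have hr := hring t ⟨by linarith [ht.1, hτA0.le], by linarith [ht.2]⟩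
    have hb := abs_le.1 (hband t ht)
    have hbsq : X t 1 ^ 2 ≤ β ^ 2 := sq_le_sq' hb.1 hb.2
    have hc0 : 0 ≤ X t 2 := hcnn t (by linarith [ht.1, hτA0.le])
    exact (sq_le_sq₀ hγ hc0).1 (by linarith)
  have hτBΔ : τB ≤ 2 * ε * β / (M * γ ^ 2 - ε ^ 2) := by
    have h := knob_clock_transit hX h0 hε hM.le hγ hγε hcγ (s := s₀ + τA) (t := s₀ + τA + τB)
      ⟨le_rfl, by linarith⟩ ⟨by linarith, le_rfl⟩ (by linarith) hb1.le
      (hnotdead (s₀ + τA + τB) ⟨by linarith, le_rfl⟩)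
    linarith
  have hτBlt : τB < H - τA := by linarith
  have hb2 : X (s₀ + τA + τB) 1 = -β := by
    have h : -X (s₀ + τA + τB) 1 = β := hBeq hτBlt
    linarith
  -- the clock stays dead while armed (part 10)
  have hdead : ∀ t ∈ Icc (s₀ + τA + τB) (s₀ + H), X t 1 ≤ -β := fun t ht =>
    clock_stays_dead hXf h0 hε.le hμ.le
      (fun r hr => hring r ⟨by linarith [hr.1, hτA0.le, hτB0.le], hr.2⟩) hnoret hb2.le ht
  exact ⟨s₀ + τA, s₀ + τA + τB, by linarith, by linarith, by linarith, halive, hb1, hband, hb2,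
    hdead, hring, hcpos⟩

/-! ## §162 The pulse window, horizon-free -/

/-- **THE PULSE WINDOW, HORIZON-FREE (knob family).** In the setting of §161 let moreover `0 < λ
≤ λ₁` be an exit level, `Δ_C = (ε/(Mβ))log(c_M/(λρ²))`, and assume `Δ_A + Δ_B + Δ_C < H`.
Then there are times `s₀ < t₁ < t₂ ≤ T`, `T - s₀ ≤ Δ_A + Δ_B + Δ_C`, `T < s₀ + H`, with the
clock alive / in transit / dead as in §161 and the catalyst DOUSED at `T = t₂ + Δ_C`: `c(T) ≤
(λ + εe^{-M}/(Mβ))ρ²` (part 5's pulse decay from the cap `c(t₂) ≤ c_M`, floor `ρ²·εe^{-M}/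
(Mβ)`); ring and `c > 0` on `[s₀, s₀ + H]` — part 18's `knob_pulse_window` with `hring`,
`hcap` in place of its allowance and budget.
[cite: Tao2016AveragedNS, §5.5 Theorem 5.3, (5.5), (b-eq), (c-eq), proof (ob-2)] -/
theorem knob_pulse_window_free
    (hX : ∀ t, HasDerivAt X (RotorKnob.rotorCircuit K M ε ρ (X t)) t)
    (h0 : X 0 = delayInit) (hε : 0 < ε) (hρ : 0 < ρ) (hρε : ρ ^ 2 ≤ ε) (hM : 0 < M)
    {s₀ H β ϱ γ lam₁ lam cM : ℝ} (hs₀ : 0 ≤ s₀) (hH : 0 < H) (hβ : 0 < β) (hβb : β < X s₀ 1)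
    (hγ : 0 ≤ γ) (hγϱ : γ ^ 2 + β ^ 2 ≤ ϱ ^ 2) (hγε : ε ^ 2 < M * γ ^ 2)
    (hring : ∀ t ∈ Icc s₀ (s₀ + H), ϱ ^ 2 ≤ X t 1 ^ 2 + X t 2 ^ 2)
    (hcap : ∀ t ∈ Icc s₀ (s₀ + H), X t 2 ≤ cM)
    (hu₁ : lam₁ * ρ ^ 2 ≤ X s₀ 2) (hlam : 0 < lam) (hlam1 : lam ≤ lam₁)
    (hΔ : ε * log (cM / (lam₁ * ρ ^ 2)) / (M * β) + 2 * ε * β / (M * γ ^ 2 - ε ^ 2)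
      + ε * log (cM / (lam * ρ ^ 2)) / (M * β) < H) :
    ∃ t₁ t₂ T : ℝ, s₀ < t₁ ∧ t₁ < t₂ ∧ t₂ ≤ T ∧
      T - s₀ ≤ ε * log (cM / (lam₁ * ρ ^ 2)) / (M * β) + 2 * ε * β / (M * γ ^ 2 - ε ^ 2)
        + ε * log (cM / (lam * ρ ^ 2)) / (M * β) ∧
      T < s₀ + H ∧
      (∀ t ∈ Icc s₀ t₁, β ≤ X t 1) ∧ X t₁ 1 = β ∧
      (∀ t ∈ Icc t₁ t₂, |X t 1| ≤ β) ∧ X t₂ 1 = -β ∧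
      (∀ t ∈ Icc t₂ (s₀ + H), X t 1 ≤ -β) ∧
      X T 2 ≤ (lam + ε * exp (-M) / (M * β)) * ρ ^ 2 ∧
      (∀ t ∈ Icc s₀ (s₀ + H), ϱ ^ 2 ≤ X t 1 ^ 2 + X t 2 ^ 2) ∧
      (∀ t ∈ Icc s₀ (s₀ + H), 0 < X t 2) := by
  obtain ⟨ΔC, hΔC⟩ : ∃ x, x = ε * log (cM / (lam * ρ ^ 2)) / (M * β) := ⟨_, rfl⟩
  rw [← hΔC] at hΔ ⊢
  have hρ2 : 0 < ρ ^ 2 := by positivity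
  have hMβ : 0 < M * β := mul_pos hM hβ
  have hlam₁ : 0 < lam₁ := lt_of_lt_of_le hlam hlam1
  have hXf := hX
  rw [RotorKnob.rotorCircuit_eq_fiveGate] at hXf
  obtain ⟨hσ0, -⟩ := knob_seed_le hε hρε hM.le
  have hμ : 0 < ε⁻¹ * M := by positivity
  -- the cap at `s₀`: `c_M ≥ λρ² > 0`, so `Δ_C ≥ 0`
  have hcM : lam * ρ ^ 2 ≤ cM := by
    have : lam * ρ ^ 2 ≤ lam₁ * ρ ^ 2 := mul_le_mul_of_nonneg_right hlam1 hρ2.le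
    exact this.trans (hu₁.trans (hcap s₀ ⟨le_rfl, by linarith⟩))
  have hcM0 : 0 < cM := lt_of_lt_of_le (by positivity) hcM
  have hyC : 0 < cM / (lam * ρ ^ 2) := by positivity
  have hΔC0 : 0 ≤ ΔC := by
    have harg : 1 ≤ cM / (lam * ρ ^ 2) := by
      rw [le_div_iff₀ (by positivity), one_mul]; exact hcM
    rw [hΔC]; exact div_nonneg (mul_nonneg hε.le (log_nonneg harg)) hMβ.le
  -- acts one and two
  obtain ⟨t₁, t₂, h01, h12, ht₂, halive, hb1, hband, hb2, hdead, hringw, hcpos⟩ :=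
    knob_clock_window_free hX h0 hε hρ hρε hM hs₀ hH hβ hβb hγ hγϱ hγε hring hcap hlam₁ hu₁
      (by linarith)
  -- ACT THREE: the catalyst douses (pulse decay, part 5) by `T = t₂ + Δ_C`
  have ht₂0 : 0 ≤ t₂ := by linarith
  have hTH : t₂ + ΔC < s₀ + H := by linarith
  have hdecay := pulse_decay hXf h0 hσ0 hμ ht₂0 hβ hdead (t := t₂ + ΔC) ⟨by linarith, hTH.le⟩
  have hprod : ε⁻¹ * M * β * (t₂ + ΔC - t₂) = log (cM / (lam * ρ ^ 2)) := by
    rw [add_sub_cancel_left, hΔC]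
    calc ε⁻¹ * M * β * (ε * log (cM / (lam * ρ ^ 2)) / (M * β))
        = ε⁻¹ * ε * log (cM / (lam * ρ ^ 2)) * (M * β / (M * β)) := by ring
      _ = log (cM / (lam * ρ ^ 2)) := by
          rw [inv_mul_cancel₀ hε.ne', div_self hMβ.ne']; ring
  have hexp : exp (-(ε⁻¹ * M * β * (t₂ + ΔC - t₂))) = lam * ρ ^ 2 / cM := by
    rw [hprod, exp_neg, exp_log hyC, inv_div]
  have hfloor : ρ ^ 2 * exp (-M) / (ε⁻¹ * M * β) = ε * exp (-M) / (M * β) * ρ ^ 2 := by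
    rw [div_eq_mul_inv, mul_inv, mul_inv, inv_inv]; ring
  have hcT : X (t₂ + ΔC) 2 ≤ (lam + ε * exp (-M) / (M * β)) * ρ ^ 2 := by
    have hct₂ : X t₂ 2 ≤ cM := hcap t₂ ⟨by linarith, by linarith⟩
    have hc20 : 0 ≤ X t₂ 2 := RotorKnob.c_nonneg hX h0 ht₂0
    have h1 : X t₂ 2 * exp (-(ε⁻¹ * M * β * (t₂ + ΔC - t₂))) ≤ lam * ρ ^ 2 := by
      calc X t₂ 2 * exp (-(ε⁻¹ * M * β * (t₂ + ΔC - t₂)))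
          ≤ cM * exp (-(ε⁻¹ * M * β * (t₂ + ΔC - t₂))) :=
            mul_le_mul_of_nonneg_right hct₂ (exp_pos _).le
        _ = lam * ρ ^ 2 := by
            rw [hexp, mul_div_assoc', mul_comm cM, mul_div_assoc, div_self hcM0.ne', mul_one]
    rw [hfloor] at hdecay
    linarith
  exact ⟨t₁, t₂, t₂ + ΔC, h01, h12, by linarith, by linarith, hTH, halive, hb1, hband, hb2, hdead,
    hcT, hringw, hcpos⟩

end Summit.NavierStokesRegularity.FluidComputer.GateBudget
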